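import Mathlib
import Literature.NumberTheory.LFunctions.ZetaZeros
import Literature.Analysis.Complex.CircleResidue
import HarnessLib

/-!
# Burnol's two complete and minimal systems attached to the zeros of `ζ` (Sonine spaces `K_a ⊂ L_a`)

LINE 1 — LABEL: RH-FREE (Hilbert-space theorems ABOUT the multiset of non-trivial zeros of `ζ`,
whatever it is; no hypothesis and no conclusion about the location of the zeros). FRAMING (cell
rh-crit, D-0074): corpus theorems are RH-FREE literature; nothing in this module is worded as
progress toward RH. bears_on: B-C/B-P (LADDER-RH COLUMN 6, de Branges framework). WHAT THIS IS NOT: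
not a route, not a criterion for RH, no positivity condition at `E_ζ` is asserted (Conrey–Li guard);
formalising which vectors are complete/minimal in which Sonine space does not move RH. Nothing here
bears on the truth of RH.

Source: J.-F. Burnol, *Two complete and minimal systems associated with the zeros of the Riemann zeta
function*, J. Théor. Nombres Bordeaux 16 (2004) 65–94 = arXiv:math/0203120 (v7, final; the TeX of
record is the cell's `dbl/src/Burnol2004JTNB_arXivmath0203120v7.tex`, statement headers quoted below
as `TeX l.nnn`, PDF pages of arXiv v7). Bib key `Burnol2004b`. This module types §2 (Sonine spaces of
de Branges and co-Poisson subspaces), §3 (statements of completeness and minimality: Thms. 3.1, 3.2,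
3.3) and §6 (the constituent propositions 6.1–6.7 from which 3.1–3.3 are assembled) AS PRINTED, as
named facts `def … : Prop` (D-0014), over honest definitions of the objects. The Hardy-space part
(§4 "Aspects of Sonine functions", §5 "Completeness of the system `ζ(s)/(s−ρ)`") is the sibling
module `BurnolZetaSystemsHardy.lean`. §7 (zeros of general Sonine functions, Thms. 7.1–7.10) is not
typed here.

## Dictionary (paper ↦ Lean), design choices

* `K = L²(0,∞; dt)`, "the elements of `K` are also tacitly viewed as even functions on `ℝ`" (§1, Note,
  TeX l.295–309) ↦ `evenL2`: the a.e.-even classes in Mathlib's `Lp ℂ 2 (volume : Measure ℝ)`. NORM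
  BOOKKEEPING: Burnol assigns the squared norm `∫₀^∞ |f|²`, i.e. HALF of `‖f‖²_{L²(ℝ)}`; every statement
  below is about closures, orthogonality, or bounds up to a constant, so the factor `2` is immaterial.
* the cosine transform `𝓕₊(f)(u) = 2∫₀^∞ cos(2πtu) f(t) dt` on `K` (TeX l.304–306) ↦ Mathlib's `L²`
  Fourier transform `𝓕 : Lp ℂ 2 ≃ₗᵢ[ℂ] Lp ℂ 2` (`MeasureTheory.Lp.fourierTransformₗᵢ`, kernel
  `e^{−2πixu}`): on EVEN functions Burnol's kernel `e^{+2πixy}` (TeX l.231–232), Mathlib's kernel and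
  the cosine kernel give the same transform, so no new operator is introduced.
* the Sonine space `K_a` (de Branges 1964) and the extended Sonine space `L_a` (TeX l.413–434) ↦
  `sonineK a`, `sonineL a` (sets of classes; `a > 0` in print, defined for all real `a`).
* the right Mellin transform `f̂(s) = ∫₀^∞ f(t) t^{−s} dt` (TeX l.350) ↦ `rightMellin f s = mellin f (1−s)`
  (Mathlib's `mellin f s = ∫₀^∞ t^{s−1} f(t) dt`). For `f ∈ L_a` it converges absolutely exactly on the
  strip `1/2 < Re s < 1` (on `(0,a)` `f` is a constant, on `(a,∞)` it is `L²`), for `f ∈ K_a` on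
  `Re s > 1/2`; its values elsewhere — in particular AT the zeros of `ζ` on or left of the critical
  line — are those of the meromorphic continuation given by Prop. 2.2. We therefore work with
  `rightMellinExt f` := THE function holomorphic on `ℂ ∖ {1}` agreeing with `f̂` on the strip when one
  exists (it is then unique, `HasRightMellinContinuation.eqOn`; Hilbert-`ε` junk otherwise), and with
  the completed transform `M(f)(s) = π^{−s/2}Γ(s/2) f̂(s)` (TeX l.439) ↦ `completedMellin f s =
  Gammaℝ s · rightMellinExt f s` (faithful off `s = 1` and off the poles `0, −2, −4, …` of `Γ_ℝ`, where
  Mathlib's `Γ` takes the junk value `0`; the non-trivial zeros of `ζ` avoid all these points).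
* the evaluators `Y^a_{w,k} ∈ L_a`, `Z^a_{w,k} ∈ K_a` (TeX l.472–484), defined in print through the
  BILINEAR form `[f,g] = ∫₀^∞ f g` by `[f, Y^a_{w,k}] = M(f)^{(k)}(w)` ↦ `burnolY a w k`, `burnolZ a w k`
  (the representing vector when it exists — Prop. 2.2 + Riesz; Hilbert-`ε` junk otherwise; the
  defining relations are the predicates `IsBurnolY`, `IsBurnolZ`).
* the non-trivial zeros `ρ` with multiplicity `m_ρ` ↦ the tree's
  `ZetaZeros.riemannZetaNontrivialZeros` and `riemannZetaZeroOrder` (`ZetaZeros.lean`); the index set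
  `{(ρ,k) : 0 ≤ k < m_ρ}` of both systems ↦ `ZetaZeroIndex`. No hypothesis on the multiplicities is
  made (TeX l.978–984).
* "minimal" / "complete" (TeX l.551–555) ↦ `IsMinimalSystem`, `IsCompleteSystemIn` (generic).
* `Y_a` (closed span of the `Y^a_{ρ,k}`) ↦ `burnolYa a`; the co-Poisson sum of `g` (eq. (11),
  TeX l.395–399) ↦ `coPoissonSum g`; the co-Poisson subspace `P_a` ↦ `coPoissonP a`.
* the second system, the inverse Mellin transforms of `ζ(s)/(s−ρ)^l`, `1 ≤ l ≤ m_ρ` (Thm. 3.3) ↦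
  `zetaQuotientVector ρ l` / `zetaQuotientSystem` over `zetaOverPow ρ l` (the quotient with its
  removable singularity at `s = ρ` filled in).

RELATION TO OTHER TREE OBJECTS (cross-reference only, nothing restated): Burnol's `K_a` become, after
the Mellin transform, de Branges spaces "with the critical line where [de Branges] has the real axis"
(TeX l.450–456); they are the Fourier-cosine analogues of Suzuki's chain `V(t) = L²(t,∞) ∩ 𝖪L²(t,∞)`
(`Literature.NumberTheory.LFunctions.suzukiV`, operator `suzukiK = 𝓕⁻¹M_{Θ_ξ}J𝓕`) — a DIFFERENT
operator (`Θ_ξ` involves `ξ′`), so no definition is shared. The Nyman–Beurling side of Burnol's work is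
the tree's `NymanBeurling*.lean` / `BaezDuarte*.lean` (Burnol 2002, Adv. Math., vectors `Y^λ_{ρ,k} ⊥ 𝓑_λ`
realised through `mellinInv`, `NymanBeurlingVectors.lean`); the present evaluators live in `L_a`, not in
`𝓑_λ^⊥`, and are not those vectors.

Deliberately NOT here: the de Branges-space axiomatics of `M(K_a)` (TeX l.452–456, [deBranges1968]);
the Remark after Thm. 3.2 on Dirichlet `L`-functions (complete AND minimal in `K_{1/√q}`, TeX l.541–549;
proved in [Burnol2004, 6.30] — a remark, not typed); §7. No statement of this module is proved here
(statements-first typing; discharges go to a sibling `…Proofs.lean`).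
-/

noncomputable section

open MeasureTheory Complex Filter Set
open scoped ComplexConjugate FourierTransform Topology ENNReal

namespace Literature.NumberTheory.LFunctions

/-! ## Generic vocabulary: complete and minimal systems (Burnol §3, TeX l.551–565) -/

section Systems

variable {ι E : Type*} [AddCommGroup E] [Module ℂ E] [TopologicalSpace E]

/-- RH-FREE (generic definition). An indexed family `u` of vectors is **complete in** the (closed)
subspace `S` if every `u i` lies in `S` and the linear span of the `u i` is dense in `S`: "is said to be
complete if the linear span of the `u_α`'s is dense in `K`" — here `K` is the ambient Hilbert space of the
statement (`L_a`, `K_a`), recorded as the set `S`. [cite: Burnol2004b, §3 (arXiv:math/0203120v7 p. 6, TeX l.551–555)] -/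
def IsCompleteSystemIn (S : Set E) (u : ι → E) : Prop :=
  (∀ i, u i ∈ S) ∧ S ⊆ closure (Submodule.span ℂ (Set.range u) : Set E)

/-- RH-FREE (generic definition). An indexed family `u` is **minimal** if "no `u_α` is in the closure of
the linear span of the `u_β`'s, `β ≠ α`". [cite: Burnol2004b, §3 (arXiv:math/0203120v7 p. 6, TeX l.551–555)] -/
def IsMinimalSystem (u : ι → E) : Prop :=
  ∀ i, u i ∉ closure (Submodule.span ℂ (u '' {j | j ≠ i}) : Set E)

end Systems

/-! ## The ambient space `K` and the Sonine spaces `K_a ⊂ L_a` (§2) -/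

/-- RH-FREE object. Burnol's `K = L²(0,∞; dt)` of EVEN square-integrable functions ("The elements of `K`
are also tacitly viewed as even functions on `ℝ`"), realised as the almost-everywhere even classes of
`L²(ℝ)`; Burnol's squared norm `∫₀^∞|f|²` is half of the `L²(ℝ)` norm (module docstring).
[cite: Burnol2004b, §1 Note (arXiv:math/0203120v7 p. 3, TeX l.295–309)] -/
def evenL2 : Set (Lp ℂ 2 (volume : Measure ℝ)) :=
  {f | ∀ᵐ x : ℝ, f (-x) = f x}

/-- RH-FREE object. De Branges' **Sonine space** `K_a ⊂ K`: "the functions in `K` which are vanishing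
identically, as well as their Fourier (cosine) transforms, in `(0,a)`" (the cosine transform of an even
class is Mathlib's `L²` Fourier transform `𝓕`, module docstring). Meaningful for `a > 0`.
[cite: Burnol2004b, §2 (arXiv:math/0203120v7 p. 5, TeX l.423–434)] -/
def sonineK (a : ℝ) : Set (Lp ℂ 2 (volume : Measure ℝ)) :=
  {f | f ∈ evenL2 ∧ (∀ᵐ x : ℝ, x ∈ Set.Ioo 0 a → f x = 0) ∧
    (∀ᵐ x : ℝ, x ∈ Set.Ioo 0 a → (𝓕 f : Lp ℂ 2 (volume : Measure ℝ)) x = 0)}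

/-- RH-FREE object. Burnol's **extended Sonine space** `L_a ⊂ K`: "the sub-Hilbert space `L_a` of `K`
consisting of functions which are constant in `(0,a)` and with their cosine transform again constant in
`(0,a)`". The `L_a`, `0 < a < ∞`, are a strictly decreasing chain with `K = closure ⋃ L_a`,
`{0} = ⋂ L_a` (TeX l.416–423; these chain properties are not typed here). Meaningful for `a > 0`.
[cite: Burnol2004b, §2 (arXiv:math/0203120v7 p. 5, TeX l.413–423)] -/
def sonineL (a : ℝ) : Set (Lp ℂ 2 (volume : Measure ℝ)) :=
  {f | f ∈ evenL2 ∧ (∃ c : ℂ, ∀ᵐ x : ℝ, x ∈ Set.Ioo 0 a → f x = c) ∧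
    (∃ c : ℂ, ∀ᵐ x : ℝ, x ∈ Set.Ioo 0 a → (𝓕 f : Lp ℂ 2 (volume : Measure ℝ)) x = c)}

/-- RH-FREE (bookkeeping). `K_a ⊆ L_a` (the constants being `0`). [cite: Burnol2004b, §2 (arXiv:math/0203120v7 p. 5, TeX l.423–428)] -/
theorem sonineK_subset_sonineL (a : ℝ) : sonineK a ⊆ sonineL a := by
  rintro f ⟨h0, h1, h2⟩
  exact ⟨h0, ⟨0, h1⟩, ⟨0, h2⟩⟩

/-! ## Right Mellin transforms and their continuation (§2, Thm. 2.1 / Prop. 2.2) -/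

/-- RH-FREE object. Burnol's **right Mellin transform** `f̂(s) = ∫₀^∞ f(t) t^{−s} dt` ("as opposed to the
left Mellin transform `∫₀^∞ f(t)t^{s−1}dt`"), i.e. Mathlib's `mellin f (1 − s)`. A Bochner integral:
meaningful where absolutely convergent (`1/2 < Re s < 1` for `f ∈ L_a`, `Re s > 1/2` for `f ∈ K_a`).
[cite: Burnol2004b, §1 (arXiv:math/0203120v7 p. 4, TeX l.350–355)] -/
def rightMellin (f : ℝ → ℂ) (s : ℂ) : ℂ :=
  mellin f (1 - s)

/-- RH-FREE (definition). `G` is a holomorphic continuation of `f̂` to `ℂ ∖ {1}`: `G` is complex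
differentiable off `s = 1` and agrees with the absolutely convergent `f̂(s)` on the open strip
`1/2 < Re s < 1`. For `f ∈ L_a` such a `G` exists (Prop. 2.2: "meromorphic in the entire complex plane,
with at most [a pole] at `1`" for the bare transform, §4 Note TeX l.614–623) and is unique
(`HasRightMellinContinuation.eqOn`). [cite: Burnol2004b, Prop. 2.2 and §4 Note (arXiv:math/0203120v7 pp. 5, 7; TeX l.460–469, 614–623)] -/
def HasRightMellinContinuation (f : ℝ → ℂ) (G : ℂ → ℂ) : Prop :=
  DifferentiableOn ℂ G {s | s ≠ 1} ∧ ∀ s : ℂ, 1 / 2 < s.re → s.re < 1 → G s = rightMellin f s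

/-- RH-FREE (uniqueness of the continuation, identity theorem on the connected open set `ℂ ∖ {1}`): two
holomorphic continuations of the same `f̂` agree off `s = 1`. This makes `rightMellinExt` canonical.
[cite: Burnol2004b, Prop. 2.2 (arXiv:math/0203120v7 p. 5, TeX l.460–469)] -/
theorem HasRightMellinContinuation.eqOn {f : ℝ → ℂ} {G₁ G₂ : ℂ → ℂ}
    (h₁ : HasRightMellinContinuation f G₁) (h₂ : HasRightMellinContinuation f G₂) :
    Set.EqOn G₁ G₂ {s | s ≠ 1} := by
  have hopen : IsOpen {s : ℂ | s ≠ 1} := isOpen_ne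
  have hconn : IsPreconnected {s : ℂ | s ≠ 1} :=
    (isConnected_compl_singleton_of_one_lt_rank (by simp) (1 : ℂ)).isPreconnected
  have ha₁ : AnalyticOnNhd ℂ G₁ {s : ℂ | s ≠ 1} := h₁.1.analyticOnNhd hopen
  have ha₂ : AnalyticOnNhd ℂ G₂ {s : ℂ | s ≠ 1} := h₂.1.analyticOnNhd hopen
  -- the point `3/4` of the strip, and agreement near it
  have h34 : (3 / 4 : ℂ) ∈ {s : ℂ | s ≠ 1} := by
    simp only [mem_setOf_eq, ne_eq]
    intro h
    have := congrArg Complex.re h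
    norm_num at this
  have hstrip : IsOpen {s : ℂ | 1 / 2 < s.re ∧ s.re < 1} :=
    (isOpen_lt continuous_const Complex.continuous_re).inter
      (isOpen_lt Complex.continuous_re continuous_const)
  have hmem : (3 / 4 : ℂ) ∈ {s : ℂ | 1 / 2 < s.re ∧ s.re < 1} := by
    simp only [mem_setOf_eq]; norm_num
  have hev : G₁ =ᶠ[𝓝 (3 / 4 : ℂ)] G₂ := by
    filter_upwards [hstrip.mem_nhds hmem] with s hs
    rw [h₁.2 s hs.1 hs.2, h₂.2 s hs.1 hs.2]
  exact ha₁.eqOn_of_preconnected_of_eventuallyEq ha₂ hconn h34 hev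

/-- RH-FREE object. **The continuation `G_f` of `f̂` to `ℂ ∖ {1}`**: the (unique) function holomorphic off
`s = 1` agreeing with `f̂` on `1/2 < Re s < 1`, when one exists (Prop. 2.2 asserts existence for every
`f ∈ L_a`); an unspecified function otherwise (Hilbert's `ε`, documented junk), and the value AT `s = 1`
is unconstrained (for `f ∈ L_a` there may be a simple pole there; for `f ∈ K_a` the printed `f̂` is
entire, Thm. 2.1). This is the function Burnol calls `f̂(s)`, `G(s)`, "an element of `L̂_a`" throughout
§§3–6. [cite: Burnol2004b, Prop. 2.2 and §4 Note (arXiv:math/0203120v7 pp. 5, 7; TeX l.460–469, 614–623)] -/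
def rightMellinExt (f : ℝ → ℂ) : ℂ → ℂ :=
  Classical.epsilon (fun G : ℂ → ℂ ↦ HasRightMellinContinuation f G)

/-- RH-FREE (the defining property of `rightMellinExt` when a continuation exists).
[cite: Burnol2004b, Prop. 2.2 (arXiv:math/0203120v7 p. 5, TeX l.460–469)] -/
theorem hasRightMellinContinuation_rightMellinExt {f : ℝ → ℂ}
    (h : ∃ G, HasRightMellinContinuation f G) : HasRightMellinContinuation f (rightMellinExt f) :=
  Classical.epsilon_spec h

/-- RH-FREE object. Burnol's **completed right Mellin transform** `M(f)(s) = π^{−s/2}Γ(s/2) f̂(s)`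
(continued), written `Γ_ℝ(s) · G_f(s)` with Mathlib's `Gammaℝ`. Faithful on `ℂ ∖ ({1} ∪ {0,−2,−4,…})`;
at the poles of `Γ_ℝ` (where Mathlib's `Γ` is `0`) the printed `M(f)` is the continuation of this
product (e.g. `M(f)` of `f ∈ K_a` is ENTIRE, Thm. 2.1). The non-trivial zeros of `ζ` (`0 < Re ρ < 1`)
are away from all these points. [cite: Burnol2004b, Thm. 2.1 / Prop. 2.2 (arXiv:math/0203120v7 p. 5, TeX l.437–469)] -/
def completedMellin (f : ℝ → ℂ) (s : ℂ) : ℂ :=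
  Gammaℝ s * rightMellinExt f s

/-- RH-FREE object. The evaluation functional `f ↦ M(f)^{(k)}(w)` (`k`-th derivative of the completed,
continued Mellin transform at `w`), the linear form represented by `Y^a_{w,k}` / `Z^a_{w,k}`
(faithful for `w ∉ {1, 0, −2, −4, …}`, see `completedMellin`).
[cite: Burnol2004b, §2 (arXiv:math/0203120v7 p. 5, TeX l.464–476)] -/
def burnolEval (f : Lp ℂ 2 (volume : Measure ℝ)) (w : ℂ) (k : ℕ) : ℂ :=
  iteratedDeriv k (completedMellin f) w

/-- RH-FREE (named fact; de Branges 1964, as quoted by Burnol, Thm. 2.1). "Let `0 < a < ∞`. Let `f(t)`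
belong to `K_a`. Then its completed right Mellin transform `M(f)(s) = π^{−s/2}Γ(s/2)f̂(s)` is an entire
function. The evaluations at complex numbers `w ∈ ℂ` are continuous linear forms on `K_a`." Typed as:
(i) `f̂` has an ENTIRE continuation `G` vanishing at `0, −2, −4, …` (equivalently `Γ_ℝ · G` is entire);
(ii) for every `w`, the value at `w` of the entire continuation `M` of `Γ_ℝ(s)f̂(s)` is bounded by
`C_w ‖f‖` on `K_a` (linearity of `f ↦ M_f(w)` is automatic from uniqueness of the continuation).
Burnol: "We gave an elementary proof of this statement in [Burnol2001CRAS]. See also [Burnol2002CRAS,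
Théorème 1]." Original: [deBranges1964]. [cite: Burnol2004b, Thm. 2.1 (arXiv:math/0203120v7 p. 5, TeX l.437–443)] -/
def Burnol2004b_thm2_1 : Prop :=
  ∀ a : ℝ, 0 < a →
    (∀ f ∈ sonineK a, ∃ G : ℂ → ℂ, Differentiable ℂ G ∧ (∀ n : ℕ, G (-2 * (n : ℂ)) = 0) ∧
      ∀ s : ℂ, 1 / 2 < s.re → s.re < 1 → G s = rightMellin f s) ∧
    (∀ w : ℂ, ∃ C : ℝ, ∀ f ∈ sonineK a, ∀ M : ℂ → ℂ, Differentiable ℂ M →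
      (∀ s : ℂ, 1 / 2 < s.re → s.re < 1 → M s = Gammaℝ s * rightMellin f s) → ‖M w‖ ≤ C * ‖f‖)

/-- RH-FREE (named fact, Prop. 2.2 = [Burnol2004, Thm. 6.10]). "Let `f(t)` belong to `L_a`. Then its
completed right Mellin transform `M(f)(s) = π^{−s/2}Γ(s/2)f̂(s)` is a meromorphic function in the entire
complex plane, with at most poles at `0` and at `1`. The evaluations `f ↦ M(f)^{(k)}(w)` for `w ≠ 0`,
`w ≠ 1`, or `f ↦ Res_{s=0}(M(f))`, `f ↦ Res_{s=1}(M(f))` are continuous linear forms on `L_a`. One has the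
functional equations `M(𝓕₊(f))(s) = M(f)(1−s)`." Typed over the bare transform (§4 Note, TeX l.614–623:
`f̂` has "trivial zeros at `−2n`, `n > 0`, and possibly a pole at `s = 1`, and possibly does not vanish
at `s = 0`"): (i) `f̂` has a holomorphic continuation `G` to `ℂ ∖ {1}` with at most a simple pole at `1`
and `G(−2n) = 0` for `n ≥ 1`; (ii) bounds `≤ C‖f‖` for the evaluations `M(f)^{(k)}(w)`
(`w ∉ {0, 1, −2, −4, …}` — at the poles `−2n`, `n ≥ 1`, of `Γ_ℝ` the printed statement also holds but our
product `completedMellin` is not the printed `M(f)` there, see its docstring), for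
`Res_{s=1} M(f) = Res_{s=1} G_f` (as `Γ_ℝ(1) = 1`) and for `G_f(0)` (as `Res_{s=0} M(f) = 2·G_f(0)`,
`Γ_ℝ` having residue `2` at `0`); (iii) the functional equation in the pole-free form
`Γ_ℝ(s) G_{𝓕f}(s) = Γ_ℝ(1−s) G_f(1−s)` for `s ∉ −2ℕ`, `s ∉ 1 + 2ℕ`. Linearity of the forms is automatic
(uniqueness of the continuation). [cite: Burnol2004b, Prop. 2.2 (arXiv:math/0203120v7 p. 5, TeX l.460–469)] -/
def Burnol2004b_prop2_2 : Prop :=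
  ∀ a : ℝ, 0 < a →
    (∀ f ∈ sonineL a, ∃ G : ℂ → ℂ, HasRightMellinContinuation f G ∧
      (∃ c : ℂ, Tendsto (fun s ↦ (s - 1) * G s) (𝓝[≠] (1 : ℂ)) (𝓝 c)) ∧
      ∀ n : ℕ, G (-2 * ((n : ℂ) + 1)) = 0) ∧
    (∀ w : ℂ, w ≠ 0 → w ≠ 1 → (∀ n : ℕ, w ≠ -2 * ((n : ℂ) + 1)) → ∀ k : ℕ,
      ∃ C : ℝ, ∀ f ∈ sonineL a, ‖burnolEval f w k‖ ≤ C * ‖f‖) ∧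
    (∃ C : ℝ, ∀ f ∈ sonineL a,
      ‖Literature.Analysis.Complex.residueAt (rightMellinExt f) 1‖ ≤ C * ‖f‖) ∧
    (∃ C : ℝ, ∀ f ∈ sonineL a, ‖rightMellinExt f 0‖ ≤ C * ‖f‖) ∧
    (∀ f ∈ sonineL a, ∀ s : ℂ, (∀ n : ℕ, s ≠ -2 * (n : ℂ)) → (∀ n : ℕ, s ≠ 1 + 2 * (n : ℂ)) →
      Gammaℝ s * rightMellinExt (𝓕 f : Lp ℂ 2 (volume : Measure ℝ)) s =
        Gammaℝ (1 - s) * rightMellinExt f (1 - s))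

/-! ## The evaluators `Y^a_{w,k} ∈ L_a`, `Z^a_{w,k} ∈ K_a` and the zero-indexed systems (§2) -/

/-- RH-FREE (defining relation). `Y` IS the evaluator `Y^a_{w,k}`: "the vector in `L_a` with
`∀ f ∈ L_a, ∫₀^∞ f(t)Y^a_{w,k}(t) dt = M(f)^{(k)}(w)`" — note the BILINEAR form `[f,g] = ∫₀^∞ f g`, "in
order to ensure that the dependency of `Y^a_{w,k}` with respect to `w` is analytic". Such `Y` exists by
Prop. 2.2 (Riesz) and is unique (non-degeneracy of `[·,·]` on the conjugation-stable space `L_a`).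
[cite: Burnol2004b, §2 (arXiv:math/0203120v7 p. 5, TeX l.472–481)] -/
def IsBurnolY (a : ℝ) (w : ℂ) (k : ℕ) (Y : Lp ℂ 2 (volume : Measure ℝ)) : Prop :=
  Y ∈ sonineL a ∧ ∀ f ∈ sonineL a, ∫ t in Set.Ioi (0 : ℝ), f t * Y t = burnolEval f w k

/-- RH-FREE object. The evaluator `Y^a_{w,k} ∈ L_a` (`[f, Y^a_{w,k}] = M(f)^{(k)}(w)` for all `f ∈ L_a`),
for `w ≠ 0, 1`: the vector satisfying `IsBurnolY` when it exists (Prop. 2.2 + Riesz; it is then unique),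
an unspecified vector otherwise (Hilbert's `ε`, documented junk). (The residue evaluators `Y^a_0`, `Y^a_1`
of TeX l.474–476 are not used by the typed statements and are not defined.)
[cite: Burnol2004b, §2 (arXiv:math/0203120v7 p. 5, TeX l.472–481)] -/
def burnolY (a : ℝ) (w : ℂ) (k : ℕ) : Lp ℂ 2 (volume : Measure ℝ) :=
  Classical.epsilon (fun Y : Lp ℂ 2 (volume : Measure ℝ) ↦ IsBurnolY a w k Y)

/-- RH-FREE (defining relation). `Z` IS the evaluator `Z^a_{w,k}` in the subspace `K_a`: the vector of
`K_a` with `[f, Z] = M(f)^{(k)}(w)` for all `f ∈ K_a`; for `w ≠ 0, 1` these "are orthogonal projections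
from `L_a` to `K_a` of the evaluators `Y^a_{w,k}`". [cite: Burnol2004b, §2 (arXiv:math/0203120v7 p. 5, TeX l.481–484)] -/
def IsBurnolZ (a : ℝ) (w : ℂ) (k : ℕ) (Z : Lp ℂ 2 (volume : Measure ℝ)) : Prop :=
  Z ∈ sonineK a ∧ ∀ f ∈ sonineK a, ∫ t in Set.Ioi (0 : ℝ), f t * Z t = burnolEval f w k

/-- RH-FREE object. The evaluator `Z^a_{w,k} ∈ K_a` (Thm. 2.1 / Prop. 2.2 + Riesz; an unspecified vector
— Hilbert's `ε`, documented junk — when no representing vector exists).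
[cite: Burnol2004b, §2 (arXiv:math/0203120v7 p. 5, TeX l.481–484)] -/
def burnolZ (a : ℝ) (w : ℂ) (k : ℕ) : Lp ℂ 2 (volume : Measure ℝ) :=
  Classical.epsilon (fun Z : Lp ℂ 2 (volume : Measure ℝ) ↦ IsBurnolZ a w k Z)

/-- RH-FREE object. The index set of both systems: pairs `(ρ, k)` with `ρ` a non-trivial zero of `ζ`
(the tree's `ZetaZeros.riemannZetaNontrivialZeros`) and `0 ≤ k < m_ρ` (`riemannZetaZeroOrder ρ`, the
multiplicity). "No hypothesis is made in this paper on the multiplicities `m_ρ`."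
[cite: Burnol2004b, §2 Definition (arXiv:math/0203120v7 p. 5, TeX l.486–491) and Note 5 (TeX l.978–984)] -/
def ZetaZeroIndex : Type :=
  {p : ℂ × ℕ // p.1 ∈ ZetaZeros.riemannZetaNontrivialZeros ∧ (p.2 : ℤ) < riemannZetaZeroOrder p.1}

/-- RH-FREE object. The first system: `(Y^a_{ρ,k})`, `ρ` a non-trivial zero, `0 ≤ k < m_ρ`, in `L_a`.
[cite: Burnol2004b, §2 Definition and Thm. 3.1 (arXiv:math/0203120v7 pp. 5–6, TeX l.486–491, 516–525)] -/
def burnolYSystem (a : ℝ) : ZetaZeroIndex → Lp ℂ 2 (volume : Measure ℝ) :=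
  fun p ↦ burnolY a p.1.1 p.1.2

/-- RH-FREE object. The system `(Z^a_{ρ,k})`, `0 ≤ k < m_ρ`, in `K_a`.
[cite: Burnol2004b, Thm. 3.2 (arXiv:math/0203120v7 p. 6, TeX l.528–539)] -/
def burnolZSystem (a : ℝ) : ZetaZeroIndex → Lp ℂ 2 (volume : Measure ℝ) :=
  fun p ↦ burnolZ a p.1.1 p.1.2

/-- RH-FREE object. `Y_a ⊂ L_a`: "the closed subspace of `L_a` which is spanned by the vectors
`Y^a_{ρ,k}`, `0 ≤ k < m_ρ`". [cite: Burnol2004b, §2 Definition (arXiv:math/0203120v7 p. 5, TeX l.486–491)] -/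
def burnolYa (a : ℝ) : Set (Lp ℂ 2 (volume : Measure ℝ)) :=
  closure (Submodule.span ℂ (Set.range (burnolYSystem a)) : Set (Lp ℂ 2 (volume : Measure ℝ)))

/-! ## Co-Poisson sums and the co-Poisson subspace `P_a` (§2) -/

/-- RH-FREE object. The **co-Poisson sum** of `g` (even, so written with `|t|`): the right-hand side
`F(t) = Σ_{n≥1} g(t/n)/n − ĝ(1)` of the co-Poisson formula (11), `ĝ(1) = ∫₀^∞ g(t) t^{−1} dt`. For `g`
supported in `[a, A]` the sum is finite for each `t` (`n ≤ |t|/a`); in general the `tsum` is Mathlib's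
(junk `0` if not summable). [cite: Burnol2004b, §2 eq. (11) (arXiv:math/0203120v7 p. 5, TeX l.393–411)] -/
def coPoissonSum (g : ℝ → ℂ) (t : ℝ) : ℂ :=
  (∑' n : ℕ, g (|t| / ((n : ℝ) + 1)) / ((n : ℂ) + 1)) - ∫ u in Set.Ioi (0 : ℝ), g u / (u : ℂ)

/-- RH-FREE object. The **co-Poisson subspace** `P_a` (`0 < a < 1` in print): "the subspace of
square-integrable functions `F(t)` which are co-Poisson sums of a function `g ∈ L¹(a, A; dt)`
(`A = 1/a`)". Burnol writes `P_a ⊂ L_a`: an `L²` co-Poisson sum is constant (`= −ĝ(1)`) on `(0,a)` with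
cosine transform constant on `(0, 1/A)` (TeX l.404–411, the co-Poisson formula of [Burnol2004]) — that
inclusion is a theorem, not built into this definition. [cite: Burnol2004b, §2 Definition (arXiv:math/0203120v7 p. 5, TeX l.493–498)] -/
def coPoissonP (a : ℝ) : Set (Lp ℂ 2 (volume : Measure ℝ)) :=
  {F | ∃ g : ℝ → ℂ, IntegrableOn g (Set.Ioo a a⁻¹) ∧ (∀ t, t ∉ Set.Ioo a a⁻¹ → g t = 0) ∧
    ∀ᵐ t : ℝ, F t = coPoissonSum g t}

/-! ## The second system: inverse Mellin transforms of `ζ(s)/(s−ρ)^l`, `1 ≤ l ≤ m_ρ` (Thm. 3.3) -/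

/-- RH-FREE object. The function `ζ(s)/(s−ρ)^l` with its removable singularity at `s = ρ` filled in by
the limit value `ζ^{(l)}(ρ)/l!` (correct whenever `ζ` vanishes to order `≥ l` at `ρ`, the only case used:
`1 ≤ l ≤ m_ρ`). The pole of `ζ` at `s = 1` is kept (functions of `L̂_1` may have a pole at `1`).
[cite: Burnol2004b, Thm. 3.3 (arXiv:math/0203120v7 p. 7, TeX l.587–594)] -/
def zetaOverPow (ρ : ℂ) (l : ℕ) (s : ℂ) : ℂ :=
  if s = ρ then iteratedDeriv l riemannZeta ρ / (l.factorial : ℂ) else riemannZeta s / (s - ρ) ^ l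

/-- RH-FREE (defining relation). `v` IS the inverse Mellin transform in `L_1` of `ζ(s)/(s−ρ)^l`: an
element of `L_1` whose right Mellin transform is `ζ(s)/(s−ρ)^l` on the strip `1/2 < Re s < 1` (hence,
by uniqueness of the continuation, on `ℂ ∖ {1}`). Existence is Prop. 4.2 (`ζ(s)/(s−ρ)^l ∈ L̂_1`);
uniqueness is Mellin–Plancherel. [cite: Burnol2004b, Thm. 3.3 and Prop. 4.2 (arXiv:math/0203120v7 pp. 7–8, TeX l.587–594, 688–691)] -/
def IsZetaQuotientVector (ρ : ℂ) (l : ℕ) (v : Lp ℂ 2 (volume : Measure ℝ)) : Prop :=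
  v ∈ sonineL 1 ∧ ∀ s : ℂ, 1 / 2 < s.re → s.re < 1 → rightMellin v s = zetaOverPow ρ l s

/-- RH-FREE object. "The vectors, inverse Mellin transforms of the functions `ζ(s)/(s−ρ)^l`,
`1 ≤ l ≤ m_ρ`" in `L_1` (the vector satisfying `IsZetaQuotientVector` when it exists — Prop. 4.2; then
unique by Mellin–Plancherel —, an unspecified vector otherwise: Hilbert's `ε`, documented junk).
[cite: Burnol2004b, Thm. 3.3 / Thm. 6.3 (arXiv:math/0203120v7 pp. 7, 16; TeX l.587–594, 1259–1266)] -/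
def zetaQuotientVector (ρ : ℂ) (l : ℕ) : Lp ℂ 2 (volume : Measure ℝ) :=
  Classical.epsilon (fun v : Lp ℂ 2 (volume : Measure ℝ) ↦ IsZetaQuotientVector ρ l v)

/-- RH-FREE object. The second system `(ζ(s)/(s−ρ)^l)`, `ρ` a non-trivial zero, `1 ≤ l ≤ m_ρ`, as vectors
of `L_1`, indexed by `(ρ, k) ∈ ZetaZeroIndex` through `l = k + 1`.
[cite: Burnol2004b, Thm. 3.3 (arXiv:math/0203120v7 p. 7, TeX l.587–594)] -/
def zetaQuotientSystem : ZetaZeroIndex → Lp ℂ 2 (volume : Measure ℝ) :=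
  fun p ↦ zetaQuotientVector p.1.1 (p.1.2 + 1)

/-! ## §3 Statements of completeness and minimality (Thms. 3.1, 3.2, 3.3) -/

/-- RH-FREE (named fact, Thm. 3.1 — the first system in `L_a`). "The vectors `Y^a_{ρ,k}`, `0 ≤ k < m_ρ`,
associated with the non-trivial zeros of the Riemann zeta function, are a minimal system in `L_a` if and
only if `a ≤ 1`. They are a complete system if and only if `a ≥ 1`. For `a < 1` the perpendicular
complement to `Y_a` is the co-Poisson subspace `P_a`. For `a > 1` we may omit arbitrarily (finitely)
many of the `Y^a_{ρ,k}`'s and still have a complete system in `L_a`." (Perpendicularity is for the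
Hermitian product of `L_a`; "It is a non-trivial fact that `P_a` … is closed. This is part of the
following two theorems", TeX l.512–514. The identification `Y_a^⊥ = P_a` is referred by Burnol to
[Burnol2004, Thms. 6.24, 6.25], TeX l.1294–1300.) Constituents: Props. 6.1, 6.2, 6.4, Thm. 6.3 below.
[cite: Burnol2004b, Thm. 3.1 (arXiv:math/0203120v7 p. 6, TeX l.516–525)] -/
def Burnol2004b_thm3_1 : Prop :=
  ∀ a : ℝ, 0 < a →
    (IsMinimalSystem (burnolYSystem a) ↔ a ≤ 1) ∧
    (IsCompleteSystemIn (sonineL a) (burnolYSystem a) ↔ 1 ≤ a) ∧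
    (a < 1 → {f | f ∈ sonineL a ∧ ∀ p : ZetaZeroIndex, inner ℂ (burnolYSystem a p) f = 0} =
      coPoissonP a) ∧
    (1 < a → ∀ S : Finset ZetaZeroIndex,
      IsCompleteSystemIn (sonineL a) (fun p : {p : ZetaZeroIndex // p ∉ S} ↦ burnolYSystem a p.1))

/-- RH-FREE (definition, the omission convention of Thm. 3.2 / Prop. 6.5 at `a = 1`). The pair `{p, q}`
of indices is an admissible omission: "one either omits `Z¹_{ρ,m_ρ−1}` and `Z¹_{ρ,m_ρ−2}` or
`Z¹_{ρ,m_ρ−1}` and `Z¹_{ρ′,m_{ρ′}−1}`" (`ρ ≠ ρ′`), i.e. `p = (ρ, m_ρ−1)` and either `q = (ρ, m_ρ−2)` or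
`q = (ρ′, m_{ρ′}−1)` with `ρ′ ≠ ρ`. [cite: Burnol2004b, Thm. 3.2 and Prop. 6.5 (arXiv:math/0203120v7 pp. 6, 16; TeX l.528–539, 1303–1310)] -/
def IsAdmissibleOmission (p q : ZetaZeroIndex) : Prop :=
  p ≠ q ∧ (p.1.2 : ℤ) + 1 = riemannZetaZeroOrder p.1.1 ∧
    ((q.1.1 = p.1.1 ∧ (q.1.2 : ℤ) + 2 = riemannZetaZeroOrder q.1.1) ∨
      (q.1.1 ≠ p.1.1 ∧ (q.1.2 : ℤ) + 1 = riemannZetaZeroOrder q.1.1))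

/-- RH-FREE (named fact, Thm. 3.2 — the evaluators in `K_a`). "The vectors `Z^a_{ρ,k}`, `0 ≤ k < m_ρ`, are
a minimal, but not complete, system for `a < 1`. They are not minimal for `a = 1`, but the system
obtained from omitting `2` arbitrarily chosen among them (with the convention that one either omits
`Z¹_{ρ,m_ρ−1}` and `Z¹_{ρ,m_ρ−2}` or `Z¹_{ρ,m_ρ−1}` and `Z¹_{ρ′,m_{ρ′}−1}`) is again a minimal system,
which is also complete in `K_1`. In the case `a > 1` the vectors `Z^a_{ρ,k}` are complete in `K_a`, even
after omitting arbitrarily (finitely) many among them." Constituents: Props. 6.5, 6.6, Thm. 6.7 below.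
(Remark TeX l.541–549, not typed: for an even primitive Dirichlet character of conductor `q` the
analogous evaluators are complete AND minimal in `K_{1/√q}`, [Burnol2004, 6.30].)
[cite: Burnol2004b, Thm. 3.2 (arXiv:math/0203120v7 p. 6, TeX l.528–539)] -/
def Burnol2004b_thm3_2 : Prop :=
  ∀ a : ℝ, 0 < a →
    (a < 1 → IsMinimalSystem (burnolZSystem a) ∧ ¬ IsCompleteSystemIn (sonineK a) (burnolZSystem a)) ∧
    (a = 1 → ¬ IsMinimalSystem (burnolZSystem 1) ∧
      ∀ p q : ZetaZeroIndex, IsAdmissibleOmission p q →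
        IsMinimalSystem (fun r : {r : ZetaZeroIndex // r ≠ p ∧ r ≠ q} ↦ burnolZSystem 1 r.1) ∧
        IsCompleteSystemIn (sonineK 1)
          (fun r : {r : ZetaZeroIndex // r ≠ p ∧ r ≠ q} ↦ burnolZSystem 1 r.1)) ∧
    (1 < a → ∀ S : Finset ZetaZeroIndex,
      IsCompleteSystemIn (sonineK a) (fun p : {p : ZetaZeroIndex // p ∉ S} ↦ burnolZSystem a p.1))

/-- RH-FREE (named fact, Thm. 3.3 — the second system). "The functions `ζ(s)/(s−ρ)^l`, for `ρ` a
non-trivial zero and `1 ≤ l ≤ m_ρ` belong to `L̂_1`. They are minimal and complete in `L̂_1`. The dual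
system consists of vectors given for each `ρ` by triangular linear combinations of the evaluators
`Y¹_{ρ,k}`, `0 ≤ k < m_ρ`." Typed: (i) existence of the vectors of `L_1` with these Mellin transforms
(= Prop. 4.2); (ii) minimality and (iii) completeness in `L_1` (`L̂_1` carries the Hilbert structure of
`L_1`); (iv) the duality, unpacked: `[v_{ρ,l}, Y¹_{ρ′,k}] = (d/ds)^k [Γ_ℝ(s)ζ(s)/(s−ρ)^l]_{s=ρ′}` vanishes
for `ρ′ ≠ ρ` and for `ρ′ = ρ`, `k + l < m_ρ`, and does not vanish for `ρ′ = ρ`, `k + l = m_ρ` — so the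
dual system is obtained from the `Y¹_{ρ,k}` by invertible triangular combinations, `ρ` by `ρ` ("it does
not seem very useful to spell them out explicitely", TeX l.574–578). Constituents: Prop. 4.2, Cor. 5.3,
Thm. 6.3. [cite: Burnol2004b, Thm. 3.3 (arXiv:math/0203120v7 p. 7, TeX l.587–594)] -/
def Burnol2004b_thm3_3 : Prop :=
  (∀ p : ZetaZeroIndex, ∃ v, IsZetaQuotientVector p.1.1 (p.1.2 + 1) v) ∧
  IsMinimalSystem zetaQuotientSystem ∧
  IsCompleteSystemIn (sonineL 1) zetaQuotientSystem ∧
  (∀ p q : ZetaZeroIndex, q.1.1 ≠ p.1.1 →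
    ∫ t in Set.Ioi (0 : ℝ), zetaQuotientSystem p t * burnolYSystem 1 q t = 0) ∧
  (∀ p q : ZetaZeroIndex, q.1.1 = p.1.1 → (q.1.2 : ℤ) + p.1.2 + 1 < riemannZetaZeroOrder p.1.1 →
    ∫ t in Set.Ioi (0 : ℝ), zetaQuotientSystem p t * burnolYSystem 1 q t = 0) ∧
  (∀ p q : ZetaZeroIndex, q.1.1 = p.1.1 → (q.1.2 : ℤ) + p.1.2 + 1 = riemannZetaZeroOrder p.1.1 →
    ∫ t in Set.Ioi (0 : ℝ), zetaQuotientSystem p t * burnolYSystem 1 q t ≠ 0)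

/-! ## §6 The constituent statements (Props. 6.1, 6.2, 6.4, 6.5, 6.6, Thms. 6.3, 6.7) -/

/-- RH-FREE (named fact, Prop. 6.1). "Let `a ≥ 1`. The vectors `Y^a_{ρ,k}` associated with the
non-trivial zeros of the Riemann zeta function are complete in `L_a`." (Printed proof: a vector `g ⊥` all
of them has `G(s) = ζ(s)θ(s)` with `θ` entire and Nevanlinna in two half-planes, hence of exponential
type `≤ max(−log a, −log a)` by Kreĭn's theorem; `< 0` for `a > 1`, and for `a = 1` minimal type + `L²` on
`Re s = 2` forces `θ = 0` by Paley–Wiener.) [cite: Burnol2004b, Prop. 6.1 (arXiv:math/0203120v7 p. 15, TeX l.1203–1239)] -/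
def Burnol2004b_prop6_1 : Prop :=
  ∀ a : ℝ, 1 ≤ a → IsCompleteSystemIn (sonineL a) (burnolYSystem a)

/-- RH-FREE (named fact, Prop. 6.2). "Let `a > 1`. The vectors `Y^a_{ρ,k}` associated with the non-trivial
zeros of the Riemann zeta function are not minimal: indeed they remain a complete system in `L_1` [sic;
read `L_a`, as in Thm. 3.1: the `Y^a_{ρ,k}` lie in the proper closed subspace `L_a ⊊ L_1`] even after
omitting arbitrarily finitely many among them." [cite: Burnol2004b, Prop. 6.2 (arXiv:math/0203120v7 p. 15, TeX l.1241–1257)] -/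
def Burnol2004b_prop6_2 : Prop :=
  ∀ a : ℝ, 1 < a → ¬ IsMinimalSystem (burnolYSystem a) ∧
    ∀ S : Finset ZetaZeroIndex,
      IsCompleteSystemIn (sonineL a) (fun p : {p : ZetaZeroIndex // p ∉ S} ↦ burnolYSystem a p.1)

/-- RH-FREE (named fact, Thm. 6.3). "Let `a = 1`. The vectors `Y¹_{ρ,k}` associated with the non-trivial
zeros of the Riemann zeta function are a minimal (and complete) system in `L_1`. The vectors, inverse
Mellin transforms of the functions `ζ(s)/(s−ρ)^l`, `1 ≤ l ≤ m_ρ`, are a minimal (and complete) system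
in `L_1`." [cite: Burnol2004b, Thm. 6.3 (arXiv:math/0203120v7 p. 16, TeX l.1259–1278)] -/
def Burnol2004b_thm6_3 : Prop :=
  (IsMinimalSystem (burnolYSystem 1) ∧ IsCompleteSystemIn (sonineL 1) (burnolYSystem 1)) ∧
  (IsMinimalSystem zetaQuotientSystem ∧ IsCompleteSystemIn (sonineL 1) zetaQuotientSystem)

/-- RH-FREE (named fact, Prop. 6.4). "Let `a < 1`. The vectors `Y^a_{ρ,k}` are minimal and not complete
in `L_a`." (Minimal: their orthogonal projections to `L_1` are the `Y¹_{ρ,k}`; not complete: the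
co-Poisson subspace `P_a ≠ 0` is orthogonal to them.) [cite: Burnol2004b, Prop. 6.4 (arXiv:math/0203120v7 p. 16, TeX l.1282–1292)] -/
def Burnol2004b_prop6_4 : Prop :=
  ∀ a : ℝ, 0 < a → a < 1 →
    IsMinimalSystem (burnolYSystem a) ∧ ¬ IsCompleteSystemIn (sonineL a) (burnolYSystem a)

/-- RH-FREE (named fact, Prop. 6.5). "The vectors `Z¹_{ρ,k}` are not minimal in `K_1`. In fact `K_1` is
spanned by these vectors even after omitting `Z¹_{ρ₁,m_{ρ₁}−1}` and `Z¹_{ρ₂,m_{ρ₂}−1}` (`ρ₁ ≠ ρ₂`), or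
`Z¹_{ρ,m_ρ−1}` and `Z¹_{ρ,m_ρ−2}` (`m_ρ ≥ 2`), from the list. This shortened system is then a minimal
system." [cite: Burnol2004b, Prop. 6.5 (arXiv:math/0203120v7 p. 16, TeX l.1303–1328)] -/
def Burnol2004b_prop6_5 : Prop :=
  ¬ IsMinimalSystem (burnolZSystem 1) ∧
    ∀ p q : ZetaZeroIndex, IsAdmissibleOmission p q →
      IsCompleteSystemIn (sonineK 1)
          (fun r : {r : ZetaZeroIndex // r ≠ p ∧ r ≠ q} ↦ burnolZSystem 1 r.1) ∧
        IsMinimalSystem (fun r : {r : ZetaZeroIndex // r ≠ p ∧ r ≠ q} ↦ burnolZSystem 1 r.1)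

/-- RH-FREE (named fact, Prop. 6.6). "Let `a > 1`. The vectors `Z^a_{ρ,k}` span `K_a` even after omitting
arbitrarily finitely many among them." [cite: Burnol2004b, Prop. 6.6 (arXiv:math/0203120v7 p. 17, TeX l.1330–1338)] -/
def Burnol2004b_prop6_6 : Prop :=
  ∀ a : ℝ, 1 < a → ∀ S : Finset ZetaZeroIndex,
    IsCompleteSystemIn (sonineK a) (fun p : {p : ZetaZeroIndex // p ∉ S} ↦ burnolZSystem a p.1)

/-- RH-FREE (named fact, Thm. 6.7). "Let `a < 1`. The vectors `Z^a_{ρ,k}` are minimal in `K_a`." (Printed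
proof for a simple zero: with `θ` smooth supported in `[a, 1/a]`, `θ̂(ρ) ≠ 0`, the vector `g_ρ ∈ K_a` with
Mellin transform `s(s−1)θ̂(s)ζ(s)/(s−ρ)` is `[·,·]`-orthogonal to every evaluator except `Z^a_{ρ,0}`; the
multiple-zero case is referred to §7.) [cite: Burnol2004b, Thm. 6.7 (arXiv:math/0203120v7 p. 17, TeX l.1340–1375)] -/
def Burnol2004b_thm6_7 : Prop :=
  ∀ a : ℝ, 0 < a → a < 1 → IsMinimalSystem (burnolZSystem a)

end Literature.NumberTheory.LFunctions
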